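import Literature.Computability.FineGrained.IPRenameYLookup
import HarnessLib

/-!
# The renaming machine of Impagliazzo–Paturi's Lemma 2, VI: the evaluator of a substituted clause

Family `fine-grained` (trunk T-CPLX-FINE). Sixth file of the machine half of Impagliazzo–Paturi's Lemma 2: the evaluator `E` that the
emission loop `cnfLoop E` of `IPRenameTruthTable.lean` calls once per tuple, for the substituted
clauses `gClause P F c` (`ForcedVariableRenaming.lean`). It scans the *annotated clause*
(`IPRenameTables.lean`: `wALit`, polarity, tag, new index of an `A`-literal / block and position
of a `B`-literal) held in `cl`.

* Programs: `satStep` (`res |= value = polarity`), `evalA` (lookup of an `A`-literal), `combine`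
  (`Ψ_x = G'_x ∨ (¬ G_x ∧ y)`), `evalB` (block pass, `Y`-lookup, combination), `evalLit`, `gBody`
  (three-state scan of the annotated clause), `evalClause`; store family `gSt`, base hypotheses
  `EvBase`, `ClBase`.
* Hypothesis forms of the sub-routines on an arbitrary store (`runs_blockPass'`, `runs_yPart'`,
  `runs_combine`, `runs_satStep'`), `bval` (the value `Ψ` computed from the tables),
  **`runs_evalB`**, the scan (`segRuns_g_*`, `alVal`, `alSat`, per-symbol budget `evK`), and
  **`runs_evalClause`**: with the annotated literals `ls` in `cl`, the flag `g` of the emission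
  bank is raised iff `alSat L zsss t ls` (some literal true under the tuple), within
  `(evK L zsss t + 10) · |cl| + 7` steps, every other register restored.

## References

* R. Impagliazzo, R. Paturi, *On the complexity of k-SAT*, J. Comput. System Sci. 62 (2001)
  367–375, doi:10.1006/jcss.2000.1727, Lemma 2 (p. 373) and its "Moreover" sentence (the
  reduction is computable within the stated time); pp. 371–372 (`G_x`, `Ψ`, `Θ_i`, `Φ_f`).
  (Not held; acquisition request acq-00143.)
* T. Nipkow, G. Klein, *Concrete Semantics with Isabelle/HOL*, Springer 2014, Ch. 7 (big-step
  reasoning about loops, as in `SymbolPrograms.lean`).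
-/

namespace Literature.Computability.FineGrained.IPRenameM

open _root_.Computability Complexity Complexity.ACom Sparsifier IPRename

/-- Updating a register outside the `Y`-lookup family commutes with it. [folklore] -/
theorem update_ySt_of_other (S : RStore) (ytw md2 iu2 ru pr val yv : List Γ') {r : Reg}
    (h0 : r ≠ kr KR.ytw) (h1 : r ≠ kr KR.md2) (h2 : r ≠ kr KR.iu2) (h3 : r ≠ kr KR.ru) (h4 : r ≠ kr KR.pr)
    (h5 : r ≠ kr KR.val) (h6 : r ≠ kr KR.yv) (u : List Γ') :
    Function.update (ySt S ytw md2 iu2 ru pr val yv) r u = ySt (Function.update S r u) ytw md2 iu2 ru pr val yv := by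
  funext r'
  by_cases h : r' = r
  · subst h; simp [ySt, h0, h1, h2, h3, h4, h5, h6]
  · rw [Function.update_of_ne h]
    simp only [ySt, Function.update_of_ne h]

/-! ### Evaluating an annotated clause: programs -/

/-- `res |= (val = pol)`: the current literal is true iff the looked-up value (flag `val`) equals
its polarity (bit in `pol`); consumes both. [folklore] -/
def satStep : RProg :=
  pop (kr KR.val) fun o => match o with
    | some _ => pop (kr KR.pol) fun o' => match o' with
        | some (Γ'.bit true) => setFlagG Γ'.blank (kr KR.res)
        | _ => skip
    | none => pop (kr KR.pol) fun o' => match o' with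
        | some (Γ'.bit false) => setFlagG Γ'.blank (kr KR.res)
        | _ => skip

/-- Evaluation of an `A`-literal: look its new index (in `pr`) up. [folklore] -/
def evalA : RProg := lookupVal ;; satStep ;; clear (kr KR.pr)

/-- `val := gt ∨ (¬ gt ∧ ¬ gf ∧ yv)` (the value `Ψ_x` of a `B`-variable from its forcing flags and
the value of its renaming variable); consumes `gt`, `gf`, `yv`. [folklore] -/
def combine : RProg :=
  pop (kr KR.gt) fun o => match o with
    | some _ => clear (kr KR.gf) ;; clear (kr KR.yv) ;; push (kr KR.val) Γ'.blank
    | none => pop (kr KR.gf) fun o' => match o' with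
        | some _ => clear (kr KR.yv)
        | none => pop (kr KR.yv) fun o'' => match o'' with
            | some _ => push (kr KR.val) Γ'.blank
            | none => skip

/-- Evaluation of a `B`-literal in block `i` (ticks in `blk` and `iu2`) at position `j` (ticks in
`pos`): the block pass, the `Y`-lookup, the combination. [folklore] -/
def evalB : RProg :=
  copyToG (kr KR.bt) (kr KR.btw) (kr KR.t1) (kr KR.t2) ;; blockPass ;; yPart ;; combine ;; satStep ;;
  clear (kr KR.done) ;; clear (kr KR.cntf)

/-- Evaluation of the literal just scanned, by its tag. [folklore] -/
def evalLit : RProg :=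
  pop (kr KR.tag) fun o => match o with
    | some (Γ'.bit false) => evalA
    | some (Γ'.bit true) => evalB
    | _ => skip

/-- Body of the scan of the annotated clause (copy in `clw`). Modes in `md`: nothing (literal
start: the polarity bit), `blank` (the tag bit), `comma` (the payload: index bits of an
`A`-literal to `pr`, kets and bras of a `B`-literal to `blk`/`iu2` and `pos`; the comma closes the
literal and evaluates it). [folklore] -/
def gBody (s : Γ') : RProg :=
  pop (kr KR.md) fun o => match o, s with
    | none, Γ'.bit p => push (kr KR.pol) (Γ'.bit p) ;; push (kr KR.md) Γ'.blank
    | some Γ'.blank, Γ'.bit t => push (kr KR.tag) (Γ'.bit t) ;; push (kr KR.md) Γ'.comma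
    | some Γ'.comma, Γ'.bit d => push (kr KR.pr) (Γ'.bit d) ;; push (kr KR.md) Γ'.comma
    | some Γ'.comma, Γ'.ket => push (kr KR.blk) Γ'.blank ;; push (kr KR.iu2) Γ'.blank ;; push (kr KR.md) Γ'.comma
    | some Γ'.comma, Γ'.bra => push (kr KR.pos) Γ'.blank ;; push (kr KR.md) Γ'.comma
    | some Γ'.comma, Γ'.comma => evalLit
    | _, _ => skip

/-- **The evaluator of an annotated clause**: with its word in `cl` (kept) and the tuple in `vt`,
raise the emission bank's flag `g` iff some literal is true. [folklore] -/
def evalClause : RProg :=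
  copyToG (kr KR.cl) (kr KR.clw) (kr KR.t1) (kr KR.t2) ;; loop (kr KR.clw) gBody ;;
  pop (kr KR.res) fun o => match o with
    | some _ => push (tb TB.g) Γ'.blank
    | none => skip

/-! ### Evaluating an annotated clause: the store family -/

/-- The store during the scan of an annotated clause. [folklore] -/
def gSt (S : RStore) (clw md pol tag pr blk iu2 pos res val : List Γ') : RStore := fun r =>
  if r = kr KR.clw then clw else
  if r = kr KR.md then md else
  if r = kr KR.pol then pol else
  if r = kr KR.tag then tag else
  if r = kr KR.pr then pr else
  if r = kr KR.blk then blk else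
  if r = kr KR.iu2 then iu2 else
  if r = kr KR.pos then pos else
  if r = kr KR.res then res else
  if r = kr KR.val then val else
  S r

section gStLemmas

variable (S : RStore) (clw md pol tag pr blk iu2 pos res val w : List Γ')

/-- Reading `clw`. [folklore] -/
@[simp] theorem gSt_clw : gSt S clw md pol tag pr blk iu2 pos res val (kr KR.clw) = clw := by simp [gSt]

/-- Reading `md`. [folklore] -/
@[simp] theorem gSt_md : gSt S clw md pol tag pr blk iu2 pos res val (kr KR.md) = md := by simp [gSt]

/-- Reading `pol`. [folklore] -/
@[simp] theorem gSt_pol : gSt S clw md pol tag pr blk iu2 pos res val (kr KR.pol) = pol := by simp [gSt]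

/-- Reading `tag`. [folklore] -/
@[simp] theorem gSt_tag : gSt S clw md pol tag pr blk iu2 pos res val (kr KR.tag) = tag := by simp [gSt]

/-- Reading `pr`. [folklore] -/
@[simp] theorem gSt_pr : gSt S clw md pol tag pr blk iu2 pos res val (kr KR.pr) = pr := by simp [gSt]

/-- Reading `blk`. [folklore] -/
@[simp] theorem gSt_blk : gSt S clw md pol tag pr blk iu2 pos res val (kr KR.blk) = blk := by simp [gSt]

/-- Reading `iu2`. [folklore] -/
@[simp] theorem gSt_iu2 : gSt S clw md pol tag pr blk iu2 pos res val (kr KR.iu2) = iu2 := by simp [gSt]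

/-- Reading `pos`. [folklore] -/
@[simp] theorem gSt_pos : gSt S clw md pol tag pr blk iu2 pos res val (kr KR.pos) = pos := by simp [gSt]

/-- Reading `res`. [folklore] -/
@[simp] theorem gSt_res : gSt S clw md pol tag pr blk iu2 pos res val (kr KR.res) = res := by simp [gSt]

/-- Reading `val`. [folklore] -/
@[simp] theorem gSt_val : gSt S clw md pol tag pr blk iu2 pos res val (kr KR.val) = val := by simp [gSt]

/-- Reading any other register. [folklore] -/
theorem gSt_other {r : Reg} (h0 : r ≠ kr KR.clw) (h1 : r ≠ kr KR.md) (h2 : r ≠ kr KR.pol) (h3 : r ≠ kr KR.tag) (h4 : r ≠ kr KR.pr) (h5 : r ≠ kr KR.blk) (h6 : r ≠ kr KR.iu2) (h7 : r ≠ kr KR.pos) (h8 : r ≠ kr KR.res) (h9 : r ≠ kr KR.val) :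
    gSt S clw md pol tag pr blk iu2 pos res val r = S r := by
  simp [gSt, h0, h1, h2, h3, h4, h5, h6, h7, h8, h9]

/-- Reading `vw`. [folklore] -/
@[simp] theorem gSt_vw' : gSt S clw md pol tag pr blk iu2 pos res val (kr KR.vw) = S (kr KR.vw) := by simp [gSt]

/-- Reading `fnd`. [folklore] -/
@[simp] theorem gSt_fnd' : gSt S clw md pol tag pr blk iu2 pos res val (kr KR.fnd) = S (kr KR.fnd) := by simp [gSt]

/-- Reading `ex`. [folklore] -/
@[simp] theorem gSt_ex' : gSt S clw md pol tag pr blk iu2 pos res val (kr KR.ex) = S (kr KR.ex) := by simp [gSt]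

/-- Reading `eb`. [folklore] -/
@[simp] theorem gSt_eb' : gSt S clw md pol tag pr blk iu2 pos res val (kr KR.eb) = S (kr KR.eb) := by simp [gSt]

/-- Reading `lmd`. [folklore] -/
@[simp] theorem gSt_lmd' : gSt S clw md pol tag pr blk iu2 pos res val (kr KR.lmd) = S (kr KR.lmd) := by simp [gSt]

/-- Reading `ne`. [folklore] -/
@[simp] theorem gSt_ne' : gSt S clw md pol tag pr blk iu2 pos res val (kr KR.ne) = S (kr KR.ne) := by simp [gSt]

/-- Reading `x2`. [folklore] -/
@[simp] theorem gSt_x2' : gSt S clw md pol tag pr blk iu2 pos res val (kr KR.x2) = S (kr KR.x2) := by simp [gSt]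

/-- Reading `t1`. [folklore] -/
@[simp] theorem gSt_t1' : gSt S clw md pol tag pr blk iu2 pos res val (kr KR.t1) = S (kr KR.t1) := by simp [gSt]

/-- Reading `t2`. [folklore] -/
@[simp] theorem gSt_t2' : gSt S clw md pol tag pr blk iu2 pos res val (kr KR.t2) = S (kr KR.t2) := by simp [gSt]

/-- Reading `btw`. [folklore] -/
@[simp] theorem gSt_btw' : gSt S clw md pol tag pr blk iu2 pos res val (kr KR.btw) = S (kr KR.btw) := by simp [gSt]

/-- Reading `md2`. [folklore] -/
@[simp] theorem gSt_md2' : gSt S clw md pol tag pr blk iu2 pos res val (kr KR.md2) = S (kr KR.md2) := by simp [gSt]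

/-- Reading `pt`. [folklore] -/
@[simp] theorem gSt_pt' : gSt S clw md pol tag pr blk iu2 pos res val (kr KR.pt) = S (kr KR.pt) := by simp [gSt]

/-- Reading `pf`. [folklore] -/
@[simp] theorem gSt_pf' : gSt S clw md pol tag pr blk iu2 pos res val (kr KR.pf) = S (kr KR.pf) := by simp [gSt]

/-- Reading `lpol`. [folklore] -/
@[simp] theorem gSt_lpol' : gSt S clw md pol tag pr blk iu2 pos res val (kr KR.lpol) = S (kr KR.lpol) := by simp [gSt]

/-- Reading `allf`. [folklore] -/
@[simp] theorem gSt_allf' : gSt S clw md pol tag pr blk iu2 pos res val (kr KR.allf) = S (kr KR.allf) := by simp [gSt]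

/-- Reading `ft`. [folklore] -/
@[simp] theorem gSt_ft' : gSt S clw md pol tag pr blk iu2 pos res val (kr KR.ft) = S (kr KR.ft) := by simp [gSt]

/-- Reading `ff`. [folklore] -/
@[simp] theorem gSt_ff' : gSt S clw md pol tag pr blk iu2 pos res val (kr KR.ff) = S (kr KR.ff) := by simp [gSt]

/-- Reading `gt`. [folklore] -/
@[simp] theorem gSt_gt' : gSt S clw md pol tag pr blk iu2 pos res val (kr KR.gt) = S (kr KR.gt) := by simp [gSt]

/-- Reading `gf`. [folklore] -/
@[simp] theorem gSt_gf' : gSt S clw md pol tag pr blk iu2 pos res val (kr KR.gf) = S (kr KR.gf) := by simp [gSt]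

/-- Reading `done`. [folklore] -/
@[simp] theorem gSt_done' : gSt S clw md pol tag pr blk iu2 pos res val (kr KR.done) = S (kr KR.done) := by simp [gSt]

/-- Reading `ru`. [folklore] -/
@[simp] theorem gSt_ru' : gSt S clw md pol tag pr blk iu2 pos res val (kr KR.ru) = S (kr KR.ru) := by simp [gSt]

/-- Reading `cntf`. [folklore] -/
@[simp] theorem gSt_cntf' : gSt S clw md pol tag pr blk iu2 pos res val (kr KR.cntf) = S (kr KR.cntf) := by simp [gSt]

/-- Reading `ytw`. [folklore] -/
@[simp] theorem gSt_ytw' : gSt S clw md pol tag pr blk iu2 pos res val (kr KR.ytw) = S (kr KR.ytw) := by simp [gSt]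

/-- Reading `yv`. [folklore] -/
@[simp] theorem gSt_yv' : gSt S clw md pol tag pr blk iu2 pos res val (kr KR.yv) = S (kr KR.yv) := by simp [gSt]

/-- Reading `bt`. [folklore] -/
@[simp] theorem gSt_bt' : gSt S clw md pol tag pr blk iu2 pos res val (kr KR.bt) = S (kr KR.bt) := by simp [gSt]

/-- Reading `yt`. [folklore] -/
@[simp] theorem gSt_yt' : gSt S clw md pol tag pr blk iu2 pos res val (kr KR.yt) = S (kr KR.yt) := by simp [gSt]

/-- Reading `cl`. [folklore] -/
@[simp] theorem gSt_cl' : gSt S clw md pol tag pr blk iu2 pos res val (kr KR.cl) = S (kr KR.cl) := by simp [gSt]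

/-- Reading an emission register. [folklore] -/
@[simp] theorem gSt_tb (x : TB) : gSt S clw md pol tag pr blk iu2 pos res val (tb x) = S (tb x) := by simp [gSt]

/-- Updating `clw`. [folklore] -/
@[simp] theorem update_gSt_clw :
    Function.update (gSt S clw md pol tag pr blk iu2 pos res val) (kr KR.clw) w = gSt S w md pol tag pr blk iu2 pos res val := by
  funext r; by_cases h : r = kr KR.clw
  · subst h; simp
  · rw [Function.update_of_ne h]; simp [gSt, h]

/-- Updating `md`. [folklore] -/
@[simp] theorem update_gSt_md :
    Function.update (gSt S clw md pol tag pr blk iu2 pos res val) (kr KR.md) w = gSt S clw w pol tag pr blk iu2 pos res val := by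
  funext r; by_cases h : r = kr KR.md
  · subst h; simp
  · rw [Function.update_of_ne h]; simp [gSt, h]

/-- Updating `pol`. [folklore] -/
@[simp] theorem update_gSt_pol :
    Function.update (gSt S clw md pol tag pr blk iu2 pos res val) (kr KR.pol) w = gSt S clw md w tag pr blk iu2 pos res val := by
  funext r; by_cases h : r = kr KR.pol
  · subst h; simp
  · rw [Function.update_of_ne h]; simp [gSt, h]

/-- Updating `tag`. [folklore] -/
@[simp] theorem update_gSt_tag :
    Function.update (gSt S clw md pol tag pr blk iu2 pos res val) (kr KR.tag) w = gSt S clw md pol w pr blk iu2 pos res val := by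
  funext r; by_cases h : r = kr KR.tag
  · subst h; simp
  · rw [Function.update_of_ne h]; simp [gSt, h]

/-- Updating `pr`. [folklore] -/
@[simp] theorem update_gSt_pr :
    Function.update (gSt S clw md pol tag pr blk iu2 pos res val) (kr KR.pr) w = gSt S clw md pol tag w blk iu2 pos res val := by
  funext r; by_cases h : r = kr KR.pr
  · subst h; simp
  · rw [Function.update_of_ne h]; simp [gSt, h]

/-- Updating `blk`. [folklore] -/
@[simp] theorem update_gSt_blk :
    Function.update (gSt S clw md pol tag pr blk iu2 pos res val) (kr KR.blk) w = gSt S clw md pol tag pr w iu2 pos res val := by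
  funext r; by_cases h : r = kr KR.blk
  · subst h; simp
  · rw [Function.update_of_ne h]; simp [gSt, h]

/-- Updating `iu2`. [folklore] -/
@[simp] theorem update_gSt_iu2 :
    Function.update (gSt S clw md pol tag pr blk iu2 pos res val) (kr KR.iu2) w = gSt S clw md pol tag pr blk w pos res val := by
  funext r; by_cases h : r = kr KR.iu2
  · subst h; simp
  · rw [Function.update_of_ne h]; simp [gSt, h]

/-- Updating `pos`. [folklore] -/
@[simp] theorem update_gSt_pos :
    Function.update (gSt S clw md pol tag pr blk iu2 pos res val) (kr KR.pos) w = gSt S clw md pol tag pr blk iu2 w res val := by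
  funext r; by_cases h : r = kr KR.pos
  · subst h; simp
  · rw [Function.update_of_ne h]; simp [gSt, h]

/-- Updating `res`. [folklore] -/
@[simp] theorem update_gSt_res :
    Function.update (gSt S clw md pol tag pr blk iu2 pos res val) (kr KR.res) w = gSt S clw md pol tag pr blk iu2 pos w val := by
  funext r; by_cases h : r = kr KR.res
  · subst h; simp
  · rw [Function.update_of_ne h]; simp [gSt, h]

/-- Updating `val`. [folklore] -/
@[simp] theorem update_gSt_val :
    Function.update (gSt S clw md pol tag pr blk iu2 pos res val) (kr KR.val) w = gSt S clw md pol tag pr blk iu2 pos res w := by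
  funext r; by_cases h : r = kr KR.val
  · subst h; simp
  · rw [Function.update_of_ne h]; simp [gSt, h]

/-- Updating a register outside the family commutes with it. [folklore] -/
theorem update_gSt_of_other {r : Reg} (h0 : r ≠ kr KR.clw) (h1 : r ≠ kr KR.md) (h2 : r ≠ kr KR.pol) (h3 : r ≠ kr KR.tag) (h4 : r ≠ kr KR.pr) (h5 : r ≠ kr KR.blk) (h6 : r ≠ kr KR.iu2) (h7 : r ≠ kr KR.pos) (h8 : r ≠ kr KR.res) (h9 : r ≠ kr KR.val) (u : List Γ') :
    Function.update (gSt S clw md pol tag pr blk iu2 pos res val) r u = gSt (Function.update S r u) clw md pol tag pr blk iu2 pos res val := by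
  funext r'
  by_cases h : r' = r
  · subst h; simp [gSt, h0, h1, h2, h3, h4, h5, h6, h7, h8, h9]
  · rw [Function.update_of_ne h]
    simp only [gSt, Function.update_of_ne h]

end gStLemmas

/-! ### Evaluating an annotated clause: specifications -/

/-- What the evaluator needs of the base store: the lookup's needs, and all registers of the
block pass and of the `Y`-lookup empty. [folklore] -/
structure EvBase (S : RStore) (L : List Lit) : Prop extends BpBase S L where
  /-- scratch -/
  btw : S (kr KR.btw) = []
  /-- scratch -/
  md2 : S (kr KR.md2) = []
  /-- scratch -/
  pt : S (kr KR.pt) = []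
  /-- scratch -/
  pf : S (kr KR.pf) = []
  /-- scratch -/
  lpol : S (kr KR.lpol) = []
  /-- scratch -/
  allf : S (kr KR.allf) = []
  /-- scratch -/
  ft : S (kr KR.ft) = []
  /-- scratch -/
  ff : S (kr KR.ff) = []
  /-- scratch -/
  gt : S (kr KR.gt) = []
  /-- scratch -/
  gf : S (kr KR.gf) = []
  /-- scratch -/
  done : S (kr KR.done) = []
  /-- scratch -/
  ru : S (kr KR.ru) = []
  /-- scratch -/
  cntf : S (kr KR.cntf) = []
  /-- scratch -/
  ytw : S (kr KR.ytw) = []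
  /-- scratch -/
  yv : S (kr KR.yv) = []

section Eval

variable (S : RStore) (L : List Lit)

/-- **`satStep`**: `res` records whether the literal of polarity `p` with value `b` is true.
[folklore] -/
theorem runs_satStep (clw md tag pr blk iu2 pos : List Γ') (p b : Bool) (R : Prop) [Decidable R] :
    Runs satStep (gSt S clw md [Γ'.bit p] tag pr blk iu2 pos (flagW Γ'.blank R) (flagW Γ'.blank (b = true)))
      (gSt S clw md [] tag pr blk iu2 pos (flagW Γ'.blank (R ∨ b = p)) []) 8 := by
  unfold satStep
  have hR : (flagW Γ'.blank R).length ≤ 1 := length_flagW_le _ _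
  cases b with
  | true =>
    rw [flagW_true _ rfl]
    refine Runs.pop_cons (k := kr KR.val) (a := Γ'.blank) (w := []) (by simp) ?_
    rw [update_gSt_val]
    refine Runs.pop_cons (k := kr KR.pol) (a := Γ'.bit p) (w := []) (by simp) ?_
    rw [update_gSt_pol]
    cases p with
    | true =>
      rw [flagW_true _ (Or.inr rfl)]
      exact (runs_setFlagG Γ'.blank (kr KR.res) _ (by simpa using hR)).of_eq (by simp) le_rfl
    | false =>
      rw [flagW_congr _ (show (R ∨ true = false) ↔ R by simp)]
      exact (Runs.skip _).mono (by norm_num)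
  | false =>
    rw [flagW_false _ Bool.false_ne_true]
    refine Runs.pop_nil (by simp) ?_
    have inner : Runs (pop (kr KR.pol) fun o' => match o' with
        | some (Γ'.bit false) => setFlagG Γ'.blank (kr KR.res)
        | _ => skip) (gSt S clw md [Γ'.bit p] tag pr blk iu2 pos (flagW Γ'.blank R) [])
        (gSt S clw md [] tag pr blk iu2 pos (flagW Γ'.blank (R ∨ false = p)) []) (4 + 2) := by
      refine Runs.pop_cons (k := kr KR.pol) (a := Γ'.bit p) (w := []) (by simp) ?_
      rw [update_gSt_pol]
      cases p with
      | false =>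
        rw [flagW_true _ (Or.inr rfl)]
        exact (runs_setFlagG Γ'.blank (kr KR.res) _ (by simpa using hR)).of_eq (by simp) le_rfl
      | true =>
        rw [flagW_congr _ (show (R ∨ false = true) ↔ R by simp)]
        exact (Runs.skip _).mono (by norm_num)
    exact inner.mono (by norm_num)

/-- **Evaluation of an `A`-literal** `(ν, p)`: `res |= (value of ν = p)`. [folklore] -/
theorem runs_evalA (hB : BpBase S L) (clw md blk iu2 pos : List Γ') (ν : ℕ) (p : Bool) (R : Prop)
    [Decidable R] :
    Runs evalA (gSt S clw md [Γ'.bit p] [] (rbits ν) blk iu2 pos (flagW Γ'.blank R) [])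
      (gSt S clw md [] [] [] blk iu2 pos (flagW Γ'.blank (R ∨ lookupB L ν = p)) [])
      ((12 * (rbits ν).length + 46) * (cbody L).length + 2 * (rbits ν).length + 19) := by
  unfold evalA
  set R0 := gSt S clw md [Γ'.bit p] [] (rbits ν) blk iu2 pos (flagW Γ'.blank R) [] with hR0
  have h1 := runs_lookupVal R0 ν L (by simp [hR0]) (by simp [hR0, hB.vt]) (by simp [hR0, hB.vw])
    (by simp [hR0, hB.fnd]) (by simp [hR0]) (by simp [hR0, hB.ex]) (by simp [hR0, hB.eb]) (by simp [hR0, hB.lmd])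
    (by simp [hR0, hB.ne]) (by simp [hR0, hB.x2]) (by simp [hR0, hB.t1]) (by simp [hR0, hB.t2])
  rw [hR0, update_gSt_val] at h1
  have h2 := runs_satStep S clw md [] (rbits ν) blk iu2 pos p (lookupB L ν) R
  have h3 := runs_clear (kr KR.pr) (gSt S clw md [] [] (rbits ν) blk iu2 pos (flagW Γ'.blank (R ∨ lookupB L ν = p)) [])
  rw [gSt_pr, update_gSt_pr] at h3
  exact (h1.seq (h2.seq h3)).mono (by omega)

end Eval

/-- Every store is a `gSt` over itself. [folklore] -/
theorem gSt_eta (R : RStore) :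
    gSt R (R (kr KR.clw)) (R (kr KR.md)) (R (kr KR.pol)) (R (kr KR.tag)) (R (kr KR.pr)) (R (kr KR.blk)) (R (kr KR.iu2)) (R (kr KR.pos)) (R (kr KR.res)) (R (kr KR.val)) = R := by
  funext r
  by_cases h0 : r = kr KR.clw
  · subst h0; simp
  by_cases h1 : r = kr KR.md
  · subst h1; simp
  by_cases h2 : r = kr KR.pol
  · subst h2; simp
  by_cases h3 : r = kr KR.tag
  · subst h3; simp
  by_cases h4 : r = kr KR.pr
  · subst h4; simp
  by_cases h5 : r = kr KR.blk
  · subst h5; simp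
  by_cases h6 : r = kr KR.iu2
  · subst h6; simp
  by_cases h7 : r = kr KR.pos
  · subst h7; simp
  by_cases h8 : r = kr KR.res
  · subst h8; simp
  by_cases h9 : r = kr KR.val
  · subst h9; simp
  rw [gSt_other _ _ _ _ _ _ _ _ _ _ _ h0 h1 h2 h3 h4 h5 h6 h7 h8 h9]

/-- Reading `gt` through the `Y`-lookup family. [folklore] -/
@[simp] theorem ySt_gt' (S : RStore) (ytw md2 iu2 ru pr val yv : List Γ') :
    ySt S ytw md2 iu2 ru pr val yv (kr KR.gt) = S (kr KR.gt) := by simp [ySt]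
/-- Reading `gf` through the `Y`-lookup family. [folklore] -/
@[simp] theorem ySt_gf' (S : RStore) (ytw md2 iu2 ru pr val yv : List Γ') :
    ySt S ytw md2 iu2 ru pr val yv (kr KR.gf) = S (kr KR.gf) := by simp [ySt]
/-- Reading `done` through the `Y`-lookup family. [folklore] -/
@[simp] theorem ySt_done' (S : RStore) (ytw md2 iu2 ru pr val yv : List Γ') :
    ySt S ytw md2 iu2 ru pr val yv (kr KR.done) = S (kr KR.done) := by simp [ySt]
/-- Reading `cntf` through the `Y`-lookup family. [folklore] -/
@[simp] theorem ySt_cntf' (S : RStore) (ytw md2 iu2 ru pr val yv : List Γ') :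
    ySt S ytw md2 iu2 ru pr val yv (kr KR.cntf) = S (kr KR.cntf) := by simp [ySt]
/-- Reading `pol` through the `Y`-lookup family. [folklore] -/
@[simp] theorem ySt_pol' (S : RStore) (ytw md2 iu2 ru pr val yv : List Γ') :
    ySt S ytw md2 iu2 ru pr val yv (kr KR.pol) = S (kr KR.pol) := by simp [ySt]
/-- Reading `res` through the `Y`-lookup family. [folklore] -/
@[simp] theorem ySt_res' (S : RStore) (ytw md2 iu2 ru pr val yv : List Γ') :
    ySt S ytw md2 iu2 ru pr val yv (kr KR.res) = S (kr KR.res) := by simp [ySt]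
/-- Reading `blk` through the `Y`-lookup family. [folklore] -/
@[simp] theorem ySt_blk' (S : RStore) (ytw md2 iu2 ru pr val yv : List Γ') :
    ySt S ytw md2 iu2 ru pr val yv (kr KR.blk) = S (kr KR.blk) := by simp [ySt]
/-- Reading `clw` through the `Y`-lookup family. [folklore] -/
@[simp] theorem ySt_clw' (S : RStore) (ytw md2 iu2 ru pr val yv : List Γ') :
    ySt S ytw md2 iu2 ru pr val yv (kr KR.clw) = S (kr KR.clw) := by simp [ySt]
/-- Reading `md` through the `Y`-lookup family. [folklore] -/
@[simp] theorem ySt_md' (S : RStore) (ytw md2 iu2 ru pr val yv : List Γ') :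
    ySt S ytw md2 iu2 ru pr val yv (kr KR.md) = S (kr KR.md) := by simp [ySt]
/-- Reading `tag` through the `Y`-lookup family. [folklore] -/
@[simp] theorem ySt_tag' (S : RStore) (ytw md2 iu2 ru pr val yv : List Γ') :
    ySt S ytw md2 iu2 ru pr val yv (kr KR.tag) = S (kr KR.tag) := by simp [ySt]
/-- Reading `pos` through the `Y`-lookup family. [folklore] -/
@[simp] theorem ySt_pos' (S : RStore) (ytw md2 iu2 ru pr val yv : List Γ') :
    ySt S ytw md2 iu2 ru pr val yv (kr KR.pos) = S (kr KR.pos) := by simp [ySt]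
/-- Reading `pol` through the block-pass family. [folklore] -/
@[simp] theorem bpSt_pol' (S : RStore) (btw md2 pt pf lpol pr allf ft ff gt gf pos done ru cntf val : List Γ') :
    bpSt S btw md2 pt pf lpol pr allf ft ff gt gf pos done ru cntf val (kr KR.pol) = S (kr KR.pol) := by simp [bpSt]
/-- Reading `res` through the block-pass family. [folklore] -/
@[simp] theorem bpSt_res' (S : RStore) (btw md2 pt pf lpol pr allf ft ff gt gf pos done ru cntf val : List Γ') :
    bpSt S btw md2 pt pf lpol pr allf ft ff gt gf pos done ru cntf val (kr KR.res) = S (kr KR.res) := by simp [bpSt]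
/-- Reading `clw` through the block-pass family. [folklore] -/
@[simp] theorem bpSt_clw' (S : RStore) (btw md2 pt pf lpol pr allf ft ff gt gf pos done ru cntf val : List Γ') :
    bpSt S btw md2 pt pf lpol pr allf ft ff gt gf pos done ru cntf val (kr KR.clw) = S (kr KR.clw) := by simp [bpSt]
/-- Reading `md` through the block-pass family. [folklore] -/
@[simp] theorem bpSt_md' (S : RStore) (btw md2 pt pf lpol pr allf ft ff gt gf pos done ru cntf val : List Γ') :
    bpSt S btw md2 pt pf lpol pr allf ft ff gt gf pos done ru cntf val (kr KR.md) = S (kr KR.md) := by simp [bpSt]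
/-- Reading `tag` through the block-pass family. [folklore] -/
@[simp] theorem bpSt_tag' (S : RStore) (btw md2 pt pf lpol pr allf ft ff gt gf pos done ru cntf val : List Γ') :
    bpSt S btw md2 pt pf lpol pr allf ft ff gt gf pos done ru cntf val (kr KR.tag) = S (kr KR.tag) := by simp [bpSt]
/-- Reading `yt` through the block-pass family. [folklore] -/
@[simp] theorem bpSt_yt' (S : RStore) (btw md2 pt pf lpol pr allf ft ff gt gf pos done ru cntf val : List Γ') :
    bpSt S btw md2 pt pf lpol pr allf ft ff gt gf pos done ru cntf val (kr KR.yt) = S (kr KR.yt) := by simp [bpSt]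
/-- Reading `yv` through the block-pass family. [folklore] -/
@[simp] theorem bpSt_yv' (S : RStore) (btw md2 pt pf lpol pr allf ft ff gt gf pos done ru cntf val : List Γ') :
    bpSt S btw md2 pt pf lpol pr allf ft ff gt gf pos done ru cntf val (kr KR.yv) = S (kr KR.yv) := by simp [bpSt]

/-- **`combine`** on any store: `val := gt ∨ (¬ gt ∧ ¬ gf ∧ yv)`, the three flags emptied.
[folklore] -/
theorem runs_combine (R : RStore) (T F Y : Prop) [Decidable T] [Decidable F] [Decidable Y]
    (hgt : R (kr KR.gt) = flagW Γ'.blank T) (hgf : R (kr KR.gf) = flagW Γ'.blank F)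
    (hyv : R (kr KR.yv) = flagW Γ'.blank Y) (hval : R (kr KR.val) = []) :
    Runs combine R
      (Function.update (Function.update (Function.update (Function.update R (kr KR.gt) []) (kr KR.gf) [])
        (kr KR.yv) []) (kr KR.val) (flagW Γ'.blank (T ∨ (¬ T ∧ ¬ F ∧ Y)))) 9 := by
  unfold combine
  have lF : (flagW Γ'.blank F).length ≤ 1 := length_flagW_le _ _
  have lY : (flagW Γ'.blank Y).length ≤ 1 := length_flagW_le _ _
  by_cases hT : T
  · rw [flagW_true _ hT] at hgt
    rw [flagW_true _ (Or.inl hT)]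
    refine Runs.pop_cons (k := kr KR.gt) (a := Γ'.blank) (w := []) hgt ?_
    have h1 := runs_clear (kr KR.gf) (Function.update R (kr KR.gt) [])
    have h2 := runs_clear (kr KR.yv) (Function.update (Function.update R (kr KR.gt) []) (kr KR.gf) [])
    have h3 := Runs.push (kr KR.val) Γ'.blank
      (Function.update (Function.update (Function.update R (kr KR.gt) []) (kr KR.gf) []) (kr KR.yv) [])
    have e1 : Function.update R (kr KR.gt) [] (kr KR.gf) = flagW Γ'.blank F := by simp [hgf]
    have e2 : Function.update (Function.update R (kr KR.gt) []) (kr KR.gf) [] (kr KR.yv) = flagW Γ'.blank Y := by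
      simp [hyv]
    have e3 : Function.update (Function.update (Function.update R (kr KR.gt) []) (kr KR.gf) []) (kr KR.yv) []
        (kr KR.val) = [] := by simp [hval]
    rw [e1] at h1; rw [e2] at h2; rw [e3] at h3
    exact (h1.seq (h2.seq h3)).mono (by omega)
  · rw [flagW_false _ hT] at hgt
    refine Runs.pop_nil hgt ?_
    have eR : Function.update R (kr KR.gt) [] = R := Function.update_eq_self_iff.2 hgt.symm
    rw [eR]
    by_cases hF : F
    · rw [flagW_true _ hF] at hgf
      have hor : ¬ (T ∨ (¬ T ∧ ¬ F ∧ Y)) := by tauto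
      rw [flagW_false _ hor]
      have etarget : Function.update (Function.update (Function.update R (kr KR.gf) []) (kr KR.yv) []) (kr KR.val) [] =
          Function.update (Function.update R (kr KR.gf) []) (kr KR.yv) [] :=
        Function.update_eq_self_iff.2 (by simp [hval])
      rw [etarget]
      have h2 := runs_clear (kr KR.yv) (Function.update R (kr KR.gf) [])
      have e2 : Function.update R (kr KR.gf) [] (kr KR.yv) = flagW Γ'.blank Y := by simp [hyv]
      rw [e2] at h2
      exact (Runs.pop_cons (k := kr KR.gf) (a := Γ'.blank) (w := []) hgf (h2.mono (by omega))).mono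
        (show 3 + 2 ≤ 7 by norm_num)
    · rw [flagW_false _ hF] at hgf
      have eF : Function.update R (kr KR.gf) [] = R := Function.update_eq_self_iff.2 hgf.symm
      rw [eF]
      have inner : Runs (pop (kr KR.yv) fun o'' => match o'' with
          | some _ => push (kr KR.val) Γ'.blank
          | none => skip) R
          (Function.update (Function.update R (kr KR.yv) []) (kr KR.val) (flagW Γ'.blank (T ∨ (¬ T ∧ ¬ F ∧ Y))))
          (1 + 2) := by
        by_cases hY : Y
        · rw [flagW_true _ hY] at hyv
          have hor : (T ∨ (¬ T ∧ ¬ F ∧ Y)) := Or.inr ⟨hT, hF, hY⟩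
          rw [flagW_true _ hor]
          refine Runs.pop_cons (k := kr KR.yv) (a := Γ'.blank) (w := []) hyv ?_
          exact Runs.push' (by simp [hval])
        · rw [flagW_false _ hY] at hyv
          have hor : ¬ (T ∨ (¬ T ∧ ¬ F ∧ Y)) := by tauto
          rw [flagW_false _ hor]
          refine (Runs.pop_nil hyv ((Runs.skip _).of_eq ?_ le_rfl)).mono (by norm_num)
          rw [Function.update_eq_self_iff.2 (show ([] : List Γ') = Function.update R (kr KR.yv) [] (kr KR.val) by
            simp [hval]), Function.update_eq_self_iff.2 hyv.symm]
      exact (Runs.pop_nil hgf inner).mono (by norm_num)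

/-- **`satStep`** on any store. [folklore] -/
theorem runs_satStep' (R : RStore) (p b : Bool) (Q : Prop) [Decidable Q]
    (hval : R (kr KR.val) = flagW Γ'.blank (b = true)) (hpol : R (kr KR.pol) = [Γ'.bit p])
    (hres : R (kr KR.res) = flagW Γ'.blank Q) :
    Runs satStep R
      (Function.update (Function.update (Function.update R (kr KR.val) []) (kr KR.pol) []) (kr KR.res)
        (flagW Γ'.blank (Q ∨ b = p))) 8 := by
  have e := gSt_eta R
  rw [hval, hpol, hres] at e
  have h := runs_satStep R (R (kr KR.clw)) (R (kr KR.md)) (R (kr KR.tag)) (R (kr KR.pr)) (R (kr KR.blk))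
    (R (kr KR.iu2)) (R (kr KR.pos)) p b Q
  rw [e] at h
  refine h.of_eq ?_ le_rfl
  funext r
  by_cases h1 : r = kr KR.res
  · subst h1; simp
  by_cases h2 : r = kr KR.pol
  · subst h2; simp
  by_cases h3 : r = kr KR.val
  · subst h3; simp
  rw [Function.update_of_ne h1, Function.update_of_ne h2, Function.update_of_ne h3]
  by_cases h4 : r = kr KR.clw; · subst h4; simp
  by_cases h5 : r = kr KR.md; · subst h5; simp
  by_cases h6 : r = kr KR.tag; · subst h6; simp
  by_cases h7 : r = kr KR.pr; · subst h7; simp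
  by_cases h8 : r = kr KR.blk; · subst h8; simp
  by_cases h9 : r = kr KR.iu2; · subst h9; simp
  by_cases h10 : r = kr KR.pos; · subst h10; simp
  rw [gSt_other _ _ _ _ _ _ _ _ _ _ _ h4 h5 h2 h6 h7 h8 h9 h10 h1 h3]

/-- **The block pass on any store** (hypothesis form of `runs_blockPass`). [folklore] -/
theorem runs_blockPass' (R : RStore) (L : List Lit) (hB : BpBase R L) (zsss : List (List (List Entry)))
    (i j : ℕ) (hi : i < zsss.length) (hj : j < (zsss[i]).length)
    (hbtw : R (kr KR.btw) = wBT zsss) (hblk : R (kr KR.blk) = ticks Γ'.blank i)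
    (hpos : R (kr KR.pos) = ticks Γ'.blank j) (hmd2 : R (kr KR.md2) = []) (hpt : R (kr KR.pt) = [])
    (hpf : R (kr KR.pf) = []) (hlpol : R (kr KR.lpol) = []) (hpr : R (kr KR.pr) = [])
    (hallf : R (kr KR.allf) = []) (hft : R (kr KR.ft) = []) (hff : R (kr KR.ff) = [])
    (hgt : R (kr KR.gt) = []) (hgf : R (kr KR.gf) = []) (hdone : R (kr KR.done) = [])
    (hru : R (kr KR.ru) = []) (hcntf : R (kr KR.cntf) = []) (hval : R (kr KR.val) = []) :
    Runs blockPass R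
      (Function.update (Function.update (Function.update (Function.update (Function.update (Function.update
        (Function.update (Function.update R (kr KR.btw) []) (kr KR.blk) []) (kr KR.gt) (gtW L zsss[i] j))
        (kr KR.gf) (gfW L zsss[i] j)) (kr KR.pos) []) (kr KR.done) [Γ'.blank]) (kr KR.ru) (ruW L zsss[i] j))
        (kr KR.cntf) (cntfW L zsss[i]))
      (bpK L * (wBT zsss).length + 8) := by
  have e := bpSt_eta R
  rw [hbtw, hmd2, hpt, hpf, hlpol, hpr, hallf, hft, hff, hgt, hgf, hpos, hdone, hru, hcntf, hval] at e
  have h := runs_blockPass R L hB zsss i j hi hj hblk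
  rw [e] at h
  refine h.of_eq ?_ le_rfl
  funext r
  by_cases h1 : r = kr KR.cntf; · subst h1; simp
  by_cases h2 : r = kr KR.ru; · subst h2; simp
  by_cases h3 : r = kr KR.done; · subst h3; simp
  by_cases h4 : r = kr KR.pos; · subst h4; simp
  by_cases h5 : r = kr KR.gf; · subst h5; simp
  by_cases h6 : r = kr KR.gt; · subst h6; simp
  by_cases h7 : r = kr KR.blk; · subst h7; simp
  by_cases h8 : r = kr KR.btw; · subst h8; simp
  rw [Function.update_of_ne h1, Function.update_of_ne h2, Function.update_of_ne h3, Function.update_of_ne h4,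
    Function.update_of_ne h5, Function.update_of_ne h6, Function.update_of_ne h7, Function.update_of_ne h8]
  by_cases g1 : r = kr KR.md2; · subst g1; simp [hmd2]
  by_cases g2 : r = kr KR.pt; · subst g2; simp [hpt]
  by_cases g3 : r = kr KR.pf; · subst g3; simp [hpf]
  by_cases g4 : r = kr KR.lpol; · subst g4; simp [hlpol]
  by_cases g5 : r = kr KR.pr; · subst g5; simp [hpr]
  by_cases g6 : r = kr KR.allf; · subst g6; simp [hallf]
  by_cases g7 : r = kr KR.ft; · subst g7; simp [hft]
  by_cases g8 : r = kr KR.ff; · subst g8; simp [hff]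
  by_cases g9 : r = kr KR.val; · subst g9; simp [hval]
  rw [bpSt_other _ _ _ _ _ _ _ _ _ _ _ _ _ _ _ _ _ h8 g1 g2 g3 g4 g5 g6 g7 g8 h6 h5 h4 h3 h2 h1 g9,
    Function.update_of_ne h7]

/-- **The `Y`-lookup on any store** (hypothesis form of `runs_yPart`). [folklore] -/
theorem runs_yPart' (R : RStore) (L : List Lit) (hB : BpBase R L) (t : List (ℕ × List ℕ)) (i r : ℕ)
    (hi : i < t.length) (hyt : R (kr KR.yt) = wYT t) (hytw : R (kr KR.ytw) = []) (hmd2 : R (kr KR.md2) = [])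
    (hiu2 : R (kr KR.iu2) = ticks Γ'.blank i) (hru : R (kr KR.ru) = ticks Γ'.blank r) (hpr : R (kr KR.pr) = [])
    (hval : R (kr KR.val) = []) (hyv : R (kr KR.yv) = []) :
    Runs yPart R
      (Function.update (Function.update (Function.update R (kr KR.iu2) []) (kr KR.ru) []) (kr KR.yv)
        (flagW Γ'.blank (yLook L (t[i]).2 r = true)))
      ((bpK L + 10) * (wYT t).length + 2 * r + 12) := by
  have e := ySt_eta R
  rw [hytw, hmd2, hiu2, hru, hpr, hval, hyv] at e
  have h := runs_yPart R L hB t i r hi hyt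
  rw [e] at h
  refine h.of_eq ?_ le_rfl
  funext q
  by_cases h1 : q = kr KR.yv; · subst h1; simp
  by_cases h2 : q = kr KR.ru; · subst h2; simp
  by_cases h3 : q = kr KR.iu2; · subst h3; simp
  rw [Function.update_of_ne h1, Function.update_of_ne h2, Function.update_of_ne h3]
  by_cases g1 : q = kr KR.ytw; · subst g1; simp [hytw]
  by_cases g2 : q = kr KR.md2; · subst g2; simp [hmd2]
  by_cases g3 : q = kr KR.pr; · subst g3; simp [hpr]
  by_cases g4 : q = kr KR.val; · subst g4; simp [hval]
  rw [ySt_other _ _ _ _ _ _ _ _ g1 g2 h3 h2 g3 g4 h1]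

/-- The base hypotheses survive an update elsewhere. [folklore] -/
theorem BpBase.update_of_ne {S : RStore} {L : List Lit} (h : BpBase S L) {r : Reg} (u : List Γ')
    (h0 : r ≠ tb TB.vt) (h1 : r ≠ kr KR.vw) (h2 : r ≠ kr KR.fnd) (h3 : r ≠ kr KR.ex) (h4 : r ≠ kr KR.eb)
    (h5 : r ≠ kr KR.lmd) (h6 : r ≠ kr KR.ne) (h7 : r ≠ kr KR.x2) (h8 : r ≠ kr KR.t1) (h9 : r ≠ kr KR.t2) :
    BpBase (Function.update S r u) L :=
  ⟨by rw [Function.update_of_ne h0.symm, h.vt], by rw [Function.update_of_ne h1.symm, h.vw],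
    by rw [Function.update_of_ne h2.symm, h.fnd], by rw [Function.update_of_ne h3.symm, h.ex],
    by rw [Function.update_of_ne h4.symm, h.eb], by rw [Function.update_of_ne h5.symm, h.lmd],
    by rw [Function.update_of_ne h6.symm, h.ne], by rw [Function.update_of_ne h7.symm, h.x2],
    by rw [Function.update_of_ne h8.symm, h.t1], by rw [Function.update_of_ne h9.symm, h.t2]⟩

/-- The value `Ψ` of the `j`-th variable of block `i` computed from the tables under the tuple
`L`: forced to true, or unforced and its renaming variable true. [folklore] -/
def bval (L : List Lit) (zsss : List (List (List Entry))) (t : List (ℕ × List ℕ)) (i j : ℕ) : Bool :=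
  let zs := (zsss[i]?).getD []
  let es := (zs[j]?).getD []
  fT L es || (!(fT L es || fF L es) && yLook L ((t[i]?).map Prod.snd |>.getD []) ((zs.take j).countP fun e => !fr L e))

/-- **Evaluation of a `B`-literal** of polarity `p` in block `i` at position `j`:
`res |= (bval = p)`. [folklore] -/
theorem runs_evalB (R : RStore) (L : List Lit) (hB : BpBase R L) (zsss : List (List (List Entry)))
    (t : List (ℕ × List ℕ)) (i j : ℕ) (hi : i < zsss.length) (hj : j < (zsss[i]).length) (hit : i < t.length)
    (p : Bool) (Q : Prop) [Decidable Q]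
    (hbt : R (kr KR.bt) = wBT zsss) (hyt : R (kr KR.yt) = wYT t) (hbtw : R (kr KR.btw) = [])
    (hblk : R (kr KR.blk) = ticks Γ'.blank i) (hiu2 : R (kr KR.iu2) = ticks Γ'.blank i)
    (hpos : R (kr KR.pos) = ticks Γ'.blank j) (hpol : R (kr KR.pol) = [Γ'.bit p])
    (hres : R (kr KR.res) = flagW Γ'.blank Q)
    (hmd2 : R (kr KR.md2) = []) (hpt : R (kr KR.pt) = []) (hpf : R (kr KR.pf) = []) (hlpol : R (kr KR.lpol) = [])
    (hpr : R (kr KR.pr) = []) (hallf : R (kr KR.allf) = []) (hft : R (kr KR.ft) = []) (hff : R (kr KR.ff) = [])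
    (hgt : R (kr KR.gt) = []) (hgf : R (kr KR.gf) = []) (hdone : R (kr KR.done) = []) (hru : R (kr KR.ru) = [])
    (hcntf : R (kr KR.cntf) = []) (hval : R (kr KR.val) = []) (hytw : R (kr KR.ytw) = []) (hyv : R (kr KR.yv) = []) :
    Runs evalB R
      (Function.update (Function.update (Function.update (Function.update (Function.update R
        (kr KR.blk) []) (kr KR.iu2) []) (kr KR.pos) []) (kr KR.pol) [])
        (kr KR.res) (flagW Γ'.blank (Q ∨ bval L zsss t i j = p)))
      ((bpK L + 14) * ((wBT zsss).length + (wYT t).length) + 44) := by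
  set zs := zsss[i] with hzs
  set r := (zs.take j).countP (fun e => !fr L e) with hr
  set c := zs.countP (fr L) with hc
  have hrj : r ≤ j := (List.countP_le_length).trans (by rw [List.length_take]; exact min_le_left _ _)
  have hcz : c ≤ zs.length := List.countP_le_length
  have hzsW : zs.length + 1 ≤ (wBT zsss).length := by
    have hmem : zs ∈ zsss := by rw [hzs]; exact List.getElem_mem hi
    have h1 : (wBlock zs).length ≤ (wBT zsss).length := by
      unfold wBT
      obtain ⟨s₁, s₂, hs⟩ := List.append_of_mem hmem
      rw [hs]; simp; omega
    have h2 : zs.length + 1 ≤ (wBlock zs).length := by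
      unfold wBlock
      simp only [List.length_append, List.length_singleton, Nat.add_le_add_iff_right, List.length_flatMap]
      have : ∀ es ∈ zs, 1 ≤ (wVar es).length := fun es _ => by simp [wVar]
      calc zs.length = (zs.map fun _ => 1).sum := by simp
        _ ≤ (zs.map fun es => (wVar es).length).sum := List.sum_le_sum (fun es hes => this es hes)
    omega
  unfold evalB
  -- copy the block table
  have h0 := runs_copyToG (a := kr KR.bt) (b := kr KR.btw) (t₁ := kr KR.t1) (t₂ := kr KR.t2)
    (by simp) (by simp) (by simp) (by simp) (by simp) (by simp) R hB.t1 hB.t2 hbtw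
  rw [hbt] at h0
  set R1 := Function.update R (kr KR.btw) (wBT zsss) with hR1
  -- the block pass
  have hB1 : BpBase R1 L := hB.update_of_ne _ (by simp) (by simp) (by simp) (by simp) (by simp) (by simp) (by simp)
    (by simp) (by simp) (by simp)
  have h1 := runs_blockPass' R1 L hB1 zsss i j hi hj (by simp [hR1]) (by simp [hR1, hblk]) (by simp [hR1, hpos])
    (by simp [hR1, hmd2]) (by simp [hR1, hpt]) (by simp [hR1, hpf]) (by simp [hR1, hlpol]) (by simp [hR1, hpr])
    (by simp [hR1, hallf]) (by simp [hR1, hft]) (by simp [hR1, hff]) (by simp [hR1, hgt]) (by simp [hR1, hgf])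
    (by simp [hR1, hdone]) (by simp [hR1, hru]) (by simp [hR1, hcntf]) (by simp [hR1, hval])
  set R2 := Function.update (Function.update (Function.update (Function.update (Function.update (Function.update
        (Function.update (Function.update R1 (kr KR.btw) []) (kr KR.blk) []) (kr KR.gt) (gtW L zsss[i] j))
        (kr KR.gf) (gfW L zsss[i] j)) (kr KR.pos) []) (kr KR.done) [Γ'.blank]) (kr KR.ru) (ruW L zsss[i] j))
        (kr KR.cntf) (cntfW L zsss[i]) with hR2
  -- the Y-lookup
  have hB2 : BpBase R2 L := by
    rw [hR2]
    refine BpBase.update_of_ne ?_ _ (by simp) (by simp) (by simp) (by simp) (by simp) (by simp) (by simp) (by simp)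
      (by simp) (by simp)
    refine BpBase.update_of_ne ?_ _ (by simp) (by simp) (by simp) (by simp) (by simp) (by simp) (by simp) (by simp)
      (by simp) (by simp)
    refine BpBase.update_of_ne ?_ _ (by simp) (by simp) (by simp) (by simp) (by simp) (by simp) (by simp) (by simp)
      (by simp) (by simp)
    refine BpBase.update_of_ne ?_ _ (by simp) (by simp) (by simp) (by simp) (by simp) (by simp) (by simp) (by simp)
      (by simp) (by simp)
    refine BpBase.update_of_ne ?_ _ (by simp) (by simp) (by simp) (by simp) (by simp) (by simp) (by simp) (by simp)
      (by simp) (by simp)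
    refine BpBase.update_of_ne ?_ _ (by simp) (by simp) (by simp) (by simp) (by simp) (by simp) (by simp) (by simp)
      (by simp) (by simp)
    refine BpBase.update_of_ne ?_ _ (by simp) (by simp) (by simp) (by simp) (by simp) (by simp) (by simp) (by simp)
      (by simp) (by simp)
    exact hB1.update_of_ne _ (by simp) (by simp) (by simp) (by simp) (by simp) (by simp) (by simp) (by simp)
      (by simp) (by simp)
  have hru2 : R2 (kr KR.ru) = ticks Γ'.blank r := by simp [hR2, ruW, hr, hzs]
  have h2 := runs_yPart' R2 L hB2 t i r hit (by simp [hR2, hR1, hyt]) (by simp [hR2, hR1, hytw])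
    (by simp [hR2, hR1, hmd2]) (by simp [hR2, hR1, hiu2]) hru2 (by simp [hR2, hR1, hpr]) (by simp [hR2, hR1, hval])
    (by simp [hR2, hR1, hyv])
  set R3 := Function.update (Function.update (Function.update R2 (kr KR.iu2) []) (kr KR.ru) []) (kr KR.yv)
    (flagW Γ'.blank (yLook L (t[i]).2 r = true)) with hR3
  -- the combination
  have hj' : j < (zsss[i]).length := hj
  have hT3 : R3 (kr KR.gt) = flagW Γ'.blank (fT L zs[j] = true) := by
    simp only [hR3, hR2, gtW, List.getElem?_eq_getElem hj']
    simp [hzs]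
  have hF3 : R3 (kr KR.gf) = flagW Γ'.blank (fF L zs[j] = true) := by
    simp only [hR3, hR2, gfW, List.getElem?_eq_getElem hj']
    simp [hzs]
  have h3 := runs_combine R3 (fT L zs[j] = true) (fF L zs[j] = true) (yLook L (t[i]).2 r = true)
    hT3 hF3 (by simp [hR3]) (by simp [hR3, hR2, hR1, hval])
  set b := bval L zsss t i j with hb
  have hbiff : (fT L zs[j] = true ∨ (¬ fT L zs[j] = true ∧ ¬ fF L zs[j] = true ∧ yLook L (t[i]).2 r = true)) ↔
      b = true := by
    have e1 : (zsss[i]?).getD [] = zs := by rw [List.getElem?_eq_getElem hi]; rfl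
    have e2 : (zs[j]?).getD [] = zs[j] := by rw [List.getElem?_eq_getElem hj]; rfl
    have e3 : ((t[i]?).map Prod.snd).getD [] = (t[i]).2 := by rw [List.getElem?_eq_getElem hit]; rfl
    rw [hb, bval]
    simp only [e1, e2, e3, ← hr]
    cases fT L zs[j] <;> cases fF L zs[j] <;> cases yLook L (t[i]).2 r <;> simp
  rw [flagW_congr _ hbiff] at h3
  set R4 := Function.update (Function.update (Function.update (Function.update R3 (kr KR.gt) []) (kr KR.gf) [])
    (kr KR.yv) []) (kr KR.val) (flagW Γ'.blank (b = true)) with hR4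
  -- the satisfaction test
  have h4 := runs_satStep' R4 p b Q (by simp [hR4]) (by simp [hR4, hR3, hR2, hR1, hpol])
    (by simp [hR4, hR3, hR2, hR1, hres])
  set R5 := Function.update (Function.update (Function.update R4 (kr KR.val) []) (kr KR.pol) []) (kr KR.res)
    (flagW Γ'.blank (Q ∨ b = p)) with hR5
  -- the cleanup
  have h5 := runs_clear (kr KR.done) R5
  have e5 : R5 (kr KR.done) = [Γ'.blank] := by simp [hR5, hR4, hR3, hR2]
  rw [e5] at h5
  set R6 := Function.update R5 (kr KR.done) [] with hR6
  have h6 := runs_clear (kr KR.cntf) R6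
  have e6 : R6 (kr KR.cntf) = ticks Γ'.blank c := by simp [hR6, hR5, hR4, hR3, hR2, cntfW, hc, hzs]
  rw [e6, length_ticks] at h6
  refine (h0.seq (h1.seq (h2.seq (h3.seq (h4.seq (h5.seq h6)))))).of_eq ?_ ?_
  · funext q
    simp only [hR6, hR5, hR4, hR3, hR2, hR1]
    by_cases q1 : q = kr KR.cntf; · subst q1; simp [hcntf]
    by_cases q2 : q = kr KR.done; · subst q2; simp [hdone]
    by_cases q3 : q = kr KR.res; · subst q3; simp
    by_cases q4 : q = kr KR.pol; · subst q4; simp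
    by_cases q5 : q = kr KR.val; · subst q5; simp [hval]
    by_cases q6 : q = kr KR.yv; · subst q6; simp [hyv]
    by_cases q7 : q = kr KR.gf; · subst q7; simp [hgf]
    by_cases q8 : q = kr KR.gt; · subst q8; simp [hgt]
    by_cases q9 : q = kr KR.ru; · subst q9; simp [hru]
    by_cases q10 : q = kr KR.iu2; · subst q10; simp
    by_cases q11 : q = kr KR.pos; · subst q11; simp
    by_cases q12 : q = kr KR.blk; · subst q12; simp
    by_cases q13 : q = kr KR.btw; · subst q13; simp [hbtw]
    simp [Function.update_of_ne, q1, q2, q3, q4, q5, q6, q7, q8, q9, q10, q11, q12, q13]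
  · simp only [List.length_singleton]
    have hK : 60 ≤ bpK L := by simp [bpK]
    nlinarith [hrj, hcz, hzsW, hj, Nat.zero_le (wYT t).length]

/-! ### Scanning an annotated clause -/

/-- The value of an annotated literal's variable under the tuple `L`, from the tables. [folklore] -/
def alVal (L : List Lit) (zsss : List (List (List Entry))) (t : List (ℕ × List ℕ)) : ALit → Bool
  | ALit.a ν _ => lookupB L ν
  | ALit.b i j _ => bval L zsss t i j

/-- The polarity of an annotated literal. [folklore] -/
def ALit.pol : ALit → Bool
  | ALit.a _ p => p
  | ALit.b _ _ p => p

/-- An annotated literal refers to existing blocks and positions of the tables. [folklore] -/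
def ALit.WF (zsss : List (List (List Entry))) (t : List (ℕ × List ℕ)) : ALit → Prop
  | ALit.a _ _ => True
  | ALit.b i j _ => i < t.length ∧ ∃ h : i < zsss.length, j < (zsss[i]).length

/-- Some annotated literal of the list is true under the tuple. [folklore] -/
def alSat (L : List Lit) (zsss : List (List (List Entry))) (t : List (ℕ × List ℕ)) (ls : List ALit) : Bool :=
  ls.any fun al => alVal L zsss t al == al.pol

/-- `alSat` of an extended list. [folklore] -/
theorem alSat_append_singleton (L : List Lit) (zsss : List (List (List Entry))) (t : List (ℕ × List ℕ))
    (ls : List ALit) (al : ALit) :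
    (alSat L zsss t ls = true ∨ alVal L zsss t al = al.pol) ↔ alSat L zsss t (ls ++ [al]) = true := by
  unfold alSat; simp [List.any_append]

/-- The per-symbol budget of the clause scan. [folklore] -/
def evK (L : List Lit) (zsss : List (List (List Entry))) (t : List (ℕ × List ℕ)) : ℕ :=
  (bpK L + 14) * ((wBT zsss).length + (wYT t).length) + 60 * ((cbody L).length + 1)

/-- What the clause scan needs of the base store. [folklore] -/
structure ClBase (S : RStore) (L : List Lit) (zsss : List (List (List Entry))) (t : List (ℕ × List ℕ)) : Prop
    extends EvBase S L where
  /-- the block table -/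
  bt : S (kr KR.bt) = wBT zsss
  /-- the `Y`-table -/
  yt : S (kr KR.yt) = wYT t

/-- Moving one copy of the repeated symbol across. [folklore] -/
theorem replicate_append_cons {α : Type} (n : ℕ) (a : α) (l : List α) :
    List.replicate n a ++ a :: l = a :: (List.replicate n a ++ l) := by
  induction n with
  | zero => rfl
  | succ n ih => rw [List.replicate_succ, List.cons_append, ih, List.cons_append]

section Scan

variable (S : RStore) (L : List Lit) (zsss : List (List (List Entry))) (t : List (ℕ × List ℕ))
  (hC : ClBase S L zsss t)
include hC

omit hC in
/-- Payload bits of an `A`-literal go to `pr`. [folklore] -/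
theorem segRuns_g_bits (pol tag blk iu2 pos res val : List Γ') :
    ∀ (u : List Bool) (rest pr : List Γ'),
      SegRuns (kr KR.clw) gBody (u.map Γ'.bit)
        (gSt S (u.map Γ'.bit ++ rest) [Γ'.comma] pol tag pr blk iu2 pos res val)
        (gSt S rest [Γ'.comma] pol tag ((u.map Γ'.bit).reverse ++ pr) blk iu2 pos res val) (6 * u.length)
  | [], rest, pr => by simpa using SegRuns.nil (kr KR.clw) gBody _
  | d :: u, rest, pr => by
    have hbody : Runs (gBody (Γ'.bit d))
        (Function.update (gSt S (Γ'.bit d :: (u.map Γ'.bit ++ rest)) [Γ'.comma] pol tag pr blk iu2 pos res val)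
          (kr KR.clw) (u.map Γ'.bit ++ rest))
        (gSt S (u.map Γ'.bit ++ rest) [Γ'.comma] pol tag (Γ'.bit d :: pr) blk iu2 pos res val) (2 + 2) := by
      rw [update_gSt_clw]
      unfold gBody
      refine Runs.pop_cons (k := kr KR.md) (a := Γ'.comma) (w := []) (by simp) ?_
      rw [update_gSt_md]
      exact ((Runs.push' (R' := gSt S (u.map Γ'.bit ++ rest) [] pol tag (Γ'.bit d :: pr) blk iu2 pos res val)
        (by simp)).seq (Runs.push' (by simp))).of_eq rfl (by norm_num)
    have ih := segRuns_g_bits pol tag blk iu2 pos res val u rest (Γ'.bit d :: pr)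
    have hk : gSt S (Γ'.bit d :: (u.map Γ'.bit ++ rest)) [Γ'.comma] pol tag pr blk iu2 pos res val (kr KR.clw) =
        Γ'.bit d :: (u.map Γ'.bit ++ rest) := by simp
    refine (SegRuns.cons hk hbody ih).cast (by simp) (by simp) (by simp) ?_
    simp only [List.length_cons]; omega

omit hC in
/-- Payload kets of a `B`-literal go to `blk` and `iu2`. [folklore] -/
theorem segRuns_g_kets (pol tag pr pos res val : List Γ') :
    ∀ (n : ℕ) (rest blk iu2 : List Γ'),
      SegRuns (kr KR.clw) gBody (List.replicate n Γ'.ket)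
        (gSt S (List.replicate n Γ'.ket ++ rest) [Γ'.comma] pol tag pr blk iu2 pos res val)
        (gSt S rest [Γ'.comma] pol tag pr (ticks Γ'.blank n ++ blk) (ticks Γ'.blank n ++ iu2) pos res val) (7 * n)
  | 0, rest, blk, iu2 => by simpa using SegRuns.nil (kr KR.clw) gBody _
  | n + 1, rest, blk, iu2 => by
    have hbody : Runs (gBody Γ'.ket)
        (Function.update (gSt S (Γ'.ket :: (List.replicate n Γ'.ket ++ rest)) [Γ'.comma] pol tag pr blk iu2 pos res val)
          (kr KR.clw) (List.replicate n Γ'.ket ++ rest))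
        (gSt S (List.replicate n Γ'.ket ++ rest) [Γ'.comma] pol tag pr (Γ'.blank :: blk) (Γ'.blank :: iu2) pos res val)
        (3 + 2) := by
      rw [update_gSt_clw]
      unfold gBody
      refine Runs.pop_cons (k := kr KR.md) (a := Γ'.comma) (w := []) (by simp) ?_
      rw [update_gSt_md]
      refine ((Runs.push' (R' := gSt S (List.replicate n Γ'.ket ++ rest) [] pol tag pr (Γ'.blank :: blk) iu2 pos res
        val) (by simp)).seq ((Runs.push' (R' := gSt S (List.replicate n Γ'.ket ++ rest) [] pol tag pr
        (Γ'.blank :: blk) (Γ'.blank :: iu2) pos res val) (by simp)).seq (Runs.push' (by simp)))).of_eq rfl (by norm_num)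
    have ih := segRuns_g_kets pol tag pr pos res val n rest (Γ'.blank :: blk) (Γ'.blank :: iu2)
    have hk : gSt S (Γ'.ket :: (List.replicate n Γ'.ket ++ rest)) [Γ'.comma] pol tag pr blk iu2 pos res val
        (kr KR.clw) = Γ'.ket :: (List.replicate n Γ'.ket ++ rest) := by simp
    refine (SegRuns.cons hk hbody ih).cast (by simp [List.replicate_succ]) (by simp [List.replicate_succ]) ?_ ?_
    · simp only [ticks, replicate_append_cons, List.replicate_succ, List.cons_append]
    · omega

omit hC in
/-- Payload bras of a `B`-literal go to `pos`. [folklore] -/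
theorem segRuns_g_bras (pol tag pr blk iu2 res val : List Γ') :
    ∀ (n : ℕ) (rest pos : List Γ'),
      SegRuns (kr KR.clw) gBody (List.replicate n Γ'.bra)
        (gSt S (List.replicate n Γ'.bra ++ rest) [Γ'.comma] pol tag pr blk iu2 pos res val)
        (gSt S rest [Γ'.comma] pol tag pr blk iu2 (ticks Γ'.blank n ++ pos) res val) (6 * n)
  | 0, rest, pos => by simpa using SegRuns.nil (kr KR.clw) gBody _
  | n + 1, rest, pos => by
    have hbody : Runs (gBody Γ'.bra)
        (Function.update (gSt S (Γ'.bra :: (List.replicate n Γ'.bra ++ rest)) [Γ'.comma] pol tag pr blk iu2 pos res val)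
          (kr KR.clw) (List.replicate n Γ'.bra ++ rest))
        (gSt S (List.replicate n Γ'.bra ++ rest) [Γ'.comma] pol tag pr blk iu2 (Γ'.blank :: pos) res val)
        (2 + 2) := by
      rw [update_gSt_clw]
      unfold gBody
      refine Runs.pop_cons (k := kr KR.md) (a := Γ'.comma) (w := []) (by simp) ?_
      rw [update_gSt_md]
      exact ((Runs.push' (R' := gSt S (List.replicate n Γ'.bra ++ rest) [] pol tag pr blk iu2 (Γ'.blank :: pos)
        res val) (by simp)).seq (Runs.push' (by simp))).of_eq rfl (by norm_num)
    have ih := segRuns_g_bras pol tag pr blk iu2 res val n rest (Γ'.blank :: pos)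
    have hk : gSt S (Γ'.bra :: (List.replicate n Γ'.bra ++ rest)) [Γ'.comma] pol tag pr blk iu2 pos res val
        (kr KR.clw) = Γ'.bra :: (List.replicate n Γ'.bra ++ rest) := by simp
    refine (SegRuns.cons hk hbody ih).cast (by simp [List.replicate_succ]) (by simp [List.replicate_succ]) ?_ ?_
    · simp only [ticks, replicate_append_cons, List.replicate_succ, List.cons_append]
    · omega

omit hC in
/-- The two head bits of an annotated literal: polarity and tag. [folklore] -/
theorem segRuns_g_head (p tg : Bool) (rest res : List Γ') :
    SegRuns (kr KR.clw) gBody [Γ'.bit p, Γ'.bit tg]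
      (gSt S (Γ'.bit p :: Γ'.bit tg :: rest) [] [] [] [] [] [] [] res [])
      (gSt S rest [Γ'.comma] [Γ'.bit p] [Γ'.bit tg] [] [] [] [] res []) 12 := by
  have h1 : Runs (gBody (Γ'.bit p))
      (Function.update (gSt S (Γ'.bit p :: Γ'.bit tg :: rest) [] [] [] [] [] [] [] res []) (kr KR.clw)
        (Γ'.bit tg :: rest))
      (gSt S (Γ'.bit tg :: rest) [Γ'.blank] [Γ'.bit p] [] [] [] [] [] res []) (2 + 2) := by
    rw [update_gSt_clw]
    unfold gBody
    refine Runs.pop_nil (by simp) ?_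
    exact ((Runs.push' (R' := gSt S (Γ'.bit tg :: rest) [] [Γ'.bit p] [] [] [] [] [] res []) (by simp)).seq
      (Runs.push' (by simp))).of_eq rfl (by norm_num)
  have h2 : Runs (gBody (Γ'.bit tg))
      (Function.update (gSt S (Γ'.bit tg :: rest) [Γ'.blank] [Γ'.bit p] [] [] [] [] [] res []) (kr KR.clw) rest)
      (gSt S rest [Γ'.comma] [Γ'.bit p] [Γ'.bit tg] [] [] [] [] res []) (2 + 2) := by
    rw [update_gSt_clw]
    unfold gBody
    refine Runs.pop_cons (k := kr KR.md) (a := Γ'.blank) (w := []) (by simp) ?_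
    rw [update_gSt_md]
    exact ((Runs.push' (R' := gSt S rest [] [Γ'.bit p] [Γ'.bit tg] [] [] [] [] res []) (by simp)).seq
      (Runs.push' (by simp))).of_eq rfl (by norm_num)
  have hk1 : gSt S (Γ'.bit p :: Γ'.bit tg :: rest) [] [] [] [] [] [] [] res [] (kr KR.clw) = Γ'.bit p :: Γ'.bit tg :: rest := by
    simp
  have hk2 : gSt S (Γ'.bit tg :: rest) [Γ'.blank] [Γ'.bit p] [] [] [] [] [] res [] (kr KR.clw) = Γ'.bit tg :: rest := by
    simp
  exact (SegRuns.cons hk1 h1 (SegRuns.single hk2 h2)).mono (by norm_num)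

end Scan

/-- Arithmetic of the `A`-literal budget. [folklore] -/
theorem alitACost_le (b c K : ℕ) (hK : 60 * (c + 1) ≤ K) :
    12 + 6 * b + ((12 * b + 46) * c + 2 * b + 19 + 2 + 2 + 2) + 2 ≤ K * (b + 3) := by
  have : (12 * b + 46) * c + 8 * b + 39 ≤ 60 * (c + 1) * (b + 3) := by nlinarith [Nat.zero_le (b * c)]
  calc 12 + 6 * b + ((12 * b + 46) * c + 2 * b + 19 + 2 + 2 + 2) + 2 = (12 * b + 46) * c + 8 * b + 39 := by ring
    _ ≤ 60 * (c + 1) * (b + 3) := this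
    _ ≤ K * (b + 3) := Nat.mul_le_mul_right _ hK

/-- The base hypotheses seen through the clause-scan family. [folklore] -/
theorem BpBase.gSt {S : RStore} {L : List Lit} (h : BpBase S L) (clw md pol tag pr blk iu2 pos res val : List Γ') :
    BpBase (gSt S clw md pol tag pr blk iu2 pos res val) L :=
  ⟨by simp [h.vt], by simp [h.vw], by simp [h.fnd], by simp [h.ex], by simp [h.eb], by simp [h.lmd], by simp [h.ne],
    by simp [h.x2], by simp [h.t1], by simp [h.t2]⟩

section Scan2

variable (S : RStore) (L : List Lit) (zsss : List (List (List Entry))) (t : List (ℕ × List ℕ))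
  (hC : ClBase S L zsss t)
include hC

/-- **An `A`-literal of the annotated clause.** [folklore] -/
theorem segRuns_g_alitA (ν : ℕ) (p : Bool) (rest : List Γ') (Q : Prop) [Decidable Q] :
    SegRuns (kr KR.clw) gBody (wALit (ALit.a ν p))
      (gSt S (wALit (ALit.a ν p) ++ rest) [] [] [] [] [] [] [] (flagW Γ'.blank Q) [])
      (gSt S rest [] [] [] [] [] [] [] (flagW Γ'.blank (Q ∨ lookupB L ν = p)) [])
      (evK L zsss t * (wALit (ALit.a ν p)).length) := by
  have hw : wALit (ALit.a ν p) = Γ'.bit p :: Γ'.bit false :: ((encodeNat ν).map Γ'.bit ++ [Γ'.comma]) := rfl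
  rw [hw]
  set u := (encodeNat ν).map Γ'.bit with hu
  have h1 := segRuns_g_head S p false (u ++ [Γ'.comma] ++ rest) (flagW Γ'.blank Q)
  have h2 := segRuns_g_bits S [Γ'.bit p] [Γ'.bit false] [] [] [] (flagW Γ'.blank Q) [] (encodeNat ν)
    ([Γ'.comma] ++ rest) []
  rw [← hu, List.append_nil] at h2
  have hrb : u.reverse = rbits ν := by rw [hu, rbits]
  rw [hrb] at h2
  have h3 : Runs (gBody Γ'.comma)
      (Function.update (gSt S ([Γ'.comma] ++ rest) [Γ'.comma] [Γ'.bit p] [Γ'.bit false] (rbits ν) [] [] []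
        (flagW Γ'.blank Q) []) (kr KR.clw) rest)
      (gSt S rest [] [] [] [] [] [] [] (flagW Γ'.blank (Q ∨ lookupB L ν = p)) [])
      (((12 * (rbits ν).length + 46) * (cbody L).length + 2 * (rbits ν).length + 19) + 2 + 2) := by
    rw [update_gSt_clw]
    unfold gBody
    refine Runs.pop_cons (k := kr KR.md) (a := Γ'.comma) (w := []) (by simp) ?_
    rw [update_gSt_md]
    unfold evalLit
    refine Runs.pop_cons (k := kr KR.tag) (a := Γ'.bit false) (w := []) (by simp) ?_
    rw [update_gSt_tag]
    exact runs_evalA S L hC.toBpBase rest [] [] [] [] ν p Q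
  have hk1 : gSt S (Γ'.bit p :: Γ'.bit false :: (u ++ [Γ'.comma]) ++ rest) [] [] [] [] [] [] [] (flagW Γ'.blank Q) []
      (kr KR.clw) = Γ'.bit p :: Γ'.bit false :: (u ++ [Γ'.comma] ++ rest) := by simp
  have hk3 : gSt S ([Γ'.comma] ++ rest) [Γ'.comma] [Γ'.bit p] [Γ'.bit false] (rbits ν) [] [] [] (flagW Γ'.blank Q) []
      (kr KR.clw) = Γ'.comma :: rest := by simp
  have h23 := h2.append (SegRuns.single hk3 h3)
  have := h1.append (h23.cast rfl (by simp) rfl le_rfl)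
  refine this.cast (by simp) (by simp) rfl ?_
  have hr : (rbits ν).length = u.length := by simp [rbits, hu]
  have hul : u.length = (encodeNat ν).length := by simp [hu]
  have hK : 60 * ((cbody L).length + 1) ≤ evK L zsss t := by unfold evK; omega
  have := alitACost_le u.length (cbody L).length (evK L zsss t) hK
  simp only [List.length_cons, List.length_append, List.length_nil, hr]
  rw [hul] at this ⊢
  linarith

/-- **A `B`-literal of the annotated clause.** [folklore] -/
theorem segRuns_g_alitB (i j : ℕ) (p : Bool) (rest : List Γ') (Q : Prop) [Decidable Q]
    (hit : i < t.length) (hi : i < zsss.length) (hj : j < (zsss[i]).length) :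
    SegRuns (kr KR.clw) gBody (wALit (ALit.b i j p))
      (gSt S (wALit (ALit.b i j p) ++ rest) [] [] [] [] [] [] [] (flagW Γ'.blank Q) [])
      (gSt S rest [] [] [] [] [] [] [] (flagW Γ'.blank (Q ∨ bval L zsss t i j = p)) [])
      (evK L zsss t * (wALit (ALit.b i j p)).length) := by
  have hw : wALit (ALit.b i j p) = Γ'.bit p :: Γ'.bit true ::
      (List.replicate i Γ'.ket ++ List.replicate j Γ'.bra ++ [Γ'.comma]) := rfl
  rw [hw]
  have h1 := segRuns_g_head S p true (List.replicate i Γ'.ket ++ List.replicate j Γ'.bra ++ [Γ'.comma] ++ rest)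
    (flagW Γ'.blank Q)
  have h2 := segRuns_g_kets S [Γ'.bit p] [Γ'.bit true] [] [] (flagW Γ'.blank Q) [] i
    (List.replicate j Γ'.bra ++ [Γ'.comma] ++ rest) [] []
  simp only [List.append_nil] at h2
  have h3 := segRuns_g_bras S [Γ'.bit p] [Γ'.bit true] [] (ticks Γ'.blank i) (ticks Γ'.blank i) (flagW Γ'.blank Q)
    [] j ([Γ'.comma] ++ rest) []
  simp only [List.append_nil] at h3
  have h4 : Runs (gBody Γ'.comma)
      (Function.update (gSt S ([Γ'.comma] ++ rest) [Γ'.comma] [Γ'.bit p] [Γ'.bit true] [] (ticks Γ'.blank i)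
        (ticks Γ'.blank i) (ticks Γ'.blank j) (flagW Γ'.blank Q) []) (kr KR.clw) rest)
      (gSt S rest [] [] [] [] [] [] [] (flagW Γ'.blank (Q ∨ bval L zsss t i j = p)) [])
      (((bpK L + 14) * ((wBT zsss).length + (wYT t).length) + 44) + 2 + 2) := by
    rw [update_gSt_clw]
    unfold gBody
    refine Runs.pop_cons (k := kr KR.md) (a := Γ'.comma) (w := []) (by simp) ?_
    rw [update_gSt_md]
    unfold evalLit
    refine Runs.pop_cons (k := kr KR.tag) (a := Γ'.bit true) (w := []) (by simp) ?_
    rw [update_gSt_tag]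
    set R := gSt S rest [] [Γ'.bit p] [] [] (ticks Γ'.blank i) (ticks Γ'.blank i) (ticks Γ'.blank j)
      (flagW Γ'.blank Q) [] with hR
    have hB : BpBase R L := hC.toBpBase.gSt _ _ _ _ _ _ _ _ _ _
    have h := runs_evalB R L hB zsss t i j hi hj hit p Q (by simp [hR, hC.bt]) (by simp [hR, hC.yt])
      (by simp [hR, hC.btw]) (by simp [hR]) (by simp [hR]) (by simp [hR]) (by simp [hR]) (by simp [hR])
      (by simp [hR, hC.md2]) (by simp [hR, hC.pt]) (by simp [hR, hC.pf]) (by simp [hR, hC.lpol]) (by simp [hR])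
      (by simp [hR, hC.allf]) (by simp [hR, hC.ft]) (by simp [hR, hC.ff]) (by simp [hR, hC.gt]) (by simp [hR, hC.gf])
      (by simp [hR, hC.done]) (by simp [hR, hC.ru]) (by simp [hR, hC.cntf]) (by simp [hR]) (by simp [hR, hC.ytw])
      (by simp [hR, hC.yv])
    refine h.of_eq ?_ le_rfl
    rw [hR]; simp
  have hk1 : gSt S (Γ'.bit p :: Γ'.bit true :: (List.replicate i Γ'.ket ++ List.replicate j Γ'.bra ++ [Γ'.comma]) ++ rest)
      [] [] [] [] [] [] [] (flagW Γ'.blank Q) [] (kr KR.clw) =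
      Γ'.bit p :: Γ'.bit true :: (List.replicate i Γ'.ket ++ List.replicate j Γ'.bra ++ [Γ'.comma] ++ rest) := by simp
  have hk4 : gSt S ([Γ'.comma] ++ rest) [Γ'.comma] [Γ'.bit p] [Γ'.bit true] [] (ticks Γ'.blank i)
      (ticks Γ'.blank i) (ticks Γ'.blank j) (flagW Γ'.blank Q) [] (kr KR.clw) = Γ'.comma :: rest := by simp
  have h34 := h3.append (SegRuns.single hk4 h4)
  have h234 := h2.append (h34.cast rfl (by simp) rfl le_rfl)
  have := h1.append (h234.cast rfl (by simp) rfl le_rfl)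
  refine this.cast (by simp) (by simp) rfl ?_
  simp only [List.length_cons, List.length_append, List.length_replicate, List.length_nil, evK]
  nlinarith [Nat.zero_le ((bpK L + 14) * ((wBT zsss).length + (wYT t).length)), Nat.zero_le (cbody L).length]

/-- **A run of annotated literals.** [folklore] -/
theorem segRuns_g_alits : ∀ (ls₂ ls₁ : List ALit) (rest : List Γ'), (∀ al ∈ ls₂, al.WF zsss t) →
    SegRuns (kr KR.clw) gBody (ls₂.flatMap wALit)
      (gSt S (ls₂.flatMap wALit ++ rest) [] [] [] [] [] [] [] (flagW Γ'.blank (alSat L zsss t ls₁ = true)) [])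
      (gSt S rest [] [] [] [] [] [] [] (flagW Γ'.blank (alSat L zsss t (ls₁ ++ ls₂) = true)) [])
      (evK L zsss t * (ls₂.flatMap wALit).length)
  | [], ls₁, rest, _ => by
    simp only [List.flatMap_nil, List.nil_append, List.length_nil, Nat.mul_zero, List.append_nil]
    exact SegRuns.nil (kr KR.clw) gBody _
  | al :: ls₂, ls₁, rest, hwf => by
    have hal := hwf al (by simp)
    have hrest : ∀ al' ∈ ls₂, al'.WF zsss t := fun al' h => hwf al' (by simp [h])
    have h1 : SegRuns (kr KR.clw) gBody (wALit al)
        (gSt S (wALit al ++ (ls₂.flatMap wALit ++ rest)) [] [] [] [] [] [] [] (flagW Γ'.blank (alSat L zsss t ls₁ = true)) [])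
        (gSt S (ls₂.flatMap wALit ++ rest) [] [] [] [] [] [] [] (flagW Γ'.blank (alSat L zsss t (ls₁ ++ [al]) = true)) [])
        (evK L zsss t * (wALit al).length) := by
      cases al with
      | a ν p =>
        have := segRuns_g_alitA S L zsss t hC ν p (ls₂.flatMap wALit ++ rest) (alSat L zsss t ls₁ = true)
        refine this.cast rfl rfl ?_ le_rfl
        rw [flagW_congr _ (show (alSat L zsss t ls₁ = true ∨ lookupB L ν = p) ↔
          alSat L zsss t (ls₁ ++ [ALit.a ν p]) = true from alSat_append_singleton L zsss t ls₁ (ALit.a ν p))]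
      | b i j p =>
        obtain ⟨hit, hi, hj⟩ := hal
        have := segRuns_g_alitB S L zsss t hC i j p (ls₂.flatMap wALit ++ rest) (alSat L zsss t ls₁ = true) hit hi hj
        refine this.cast rfl rfl ?_ le_rfl
        rw [flagW_congr _ (show (alSat L zsss t ls₁ = true ∨ bval L zsss t i j = p) ↔
          alSat L zsss t (ls₁ ++ [ALit.b i j p]) = true from alSat_append_singleton L zsss t ls₁ (ALit.b i j p))]
    have h2 := segRuns_g_alits ls₂ (ls₁ ++ [al]) rest hrest
    rw [List.append_assoc, List.singleton_append] at h2
    have := h1.append h2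
    refine this.cast (by simp) (by simp) rfl ?_
    simp only [List.flatMap_cons, List.length_append]; ring_nf; omega

/-- **Specification of the clause evaluator** on any store: the flag `g` of the emission bank is
raised iff some annotated literal of `cl` is true under the tuple in `vt`. [folklore] -/
theorem runs_evalClause (ls : List ALit) (hwf : ∀ al ∈ ls, al.WF zsss t) (hcl : S (kr KR.cl) = ls.flatMap wALit)
    (hclw : S (kr KR.clw) = []) (hmd : S (kr KR.md) = []) (hpol : S (kr KR.pol) = []) (htag : S (kr KR.tag) = [])
    (hpr : S (kr KR.pr) = []) (hblk : S (kr KR.blk) = []) (hiu2 : S (kr KR.iu2) = []) (hpos : S (kr KR.pos) = [])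
    (hres : S (kr KR.res) = []) (hval : S (kr KR.val) = []) (hg : S (tb TB.g) = []) :
    Runs evalClause S (Function.update S (tb TB.g) (flagW Γ'.blank (alSat L zsss t ls = true)))
      ((evK L zsss t + 10) * (ls.flatMap wALit).length + 7) := by
  have e := gSt_eta S
  rw [hclw, hmd, hpol, htag, hpr, hblk, hiu2, hpos, hres, hval] at e
  unfold evalClause
  have h0 := runs_copyToG (a := kr KR.cl) (b := kr KR.clw) (t₁ := kr KR.t1) (t₂ := kr KR.t2)
    (by simp) (by simp) (by simp) (by simp) (by simp) (by simp) S hC.t1 hC.t2 hclw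
  rw [hcl] at h0
  have h0' : Runs (copyToG (kr KR.cl) (kr KR.clw) (kr KR.t1) (kr KR.t2)) S
      (gSt S (ls.flatMap wALit ++ []) [] [] [] [] [] [] [] (flagW Γ'.blank (alSat L zsss t [] = true)) [])
      (10 * (ls.flatMap wALit).length + 3) := by
    refine h0.of_eq ?_ le_rfl
    conv_lhs => rw [← e]
    rw [update_gSt_clw, flagW_false _ (by simp [alSat]), List.append_nil]
  have h1 := (segRuns_g_alits S L zsss t hC ls [] [] hwf).runs_loop_nil (by simp)
  rw [List.nil_append] at h1
  have h2 : Runs (pop (kr KR.res) fun o => match o with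
      | some _ => push (tb TB.g) Γ'.blank
      | none => skip)
      (gSt S [] [] [] [] [] [] [] [] (flagW Γ'.blank (alSat L zsss t ls = true)) [])
      (Function.update S (tb TB.g) (flagW Γ'.blank (alSat L zsss t ls = true))) (1 + 2) := by
    by_cases hs : alSat L zsss t ls = true
    · rw [flagW_true _ hs]
      refine Runs.pop_cons (k := kr KR.res) (a := Γ'.blank) (w := []) (by simp) ?_
      rw [update_gSt_res]
      refine Runs.push' ?_
      rw [e]; simp [hg]
    · rw [flagW_false _ hs]
      refine (Runs.pop_nil (by simp) ((Runs.skip _).of_eq ?_ le_rfl)).mono (by norm_num)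
      rw [e]; exact (Function.update_eq_self_iff.2 hg.symm).symm
  exact (h0'.seq (h1.seq h2)).mono (by nlinarith)

end Scan2

end Literature.Computability.FineGrained.IPRenameM
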